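import Literature.Probability.RandomPlanarGeometry.LoewnerSlitMaps
import HarnessLib

/-!
# The slit maps at the terminal time: `g_u → g_A` as the slit closes up the arc hull

Second half of the tree's function-theoretic proof of Loewner's slit theorem for the boundary
path `γ : [0, 1] → ℍ̄` of an arc hull `A ∈ 𝒬₊` (`LoewnerSlitMaps`,
`Literature.Probability.RandomPlanarGeometry.SlitArcData`; target
`Literature.Probability.RandomPlanarGeometry.IsArcHull.exists_loewner_chain`). [LSW]
(Lawler–Schramm–Werner, *Conformal restriction: the chordal case* (2003), proof of Lemma 3.5,
p. 13) apply "the chordal version of Loewner's theorem" to the CLOSED path `β[0, s]`, using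
`Φ_s = Φ_{E_δ}`: the map of the full slit is the map of the hull `E_δ` enclosed by the path. In
the hydrodynamic frame this is the convergence **`g_u → g_A` as `u ↑ 1`** (uniformly on `ℍ ∖ A`)
together with **`b(u) → hcap(A)`** and the collapse of the enclosed region:
**`g_u((A ∩ ℍ) ∖ γ[0, u]) → U_u`**. All three follow from the length–area modulus for ENCLOSED
sets (`Literature.Analysis.Complex.LengthArea.norm_sub_le_of_isEnclosedBy`, `LengthAreaEnclosure`):
the set `Q_u = (A ∩ ℍ) ∖ γ[0, u]` is preconnected (`isPreconnected_inter_diff_slit`: every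
component of `int A` accumulates at the remaining arc `γ(u, 1)`, else it would be a bounded
clopen piece of the connected `H_u`) and every path from `Q_u` to `∞` in `H_u = ℍ ∖ γ[0, u]`
crosses `∂A ∩ ℍ = γ(0, 1)` off `γ[0, u]`, i.e. passes through the small arc `γ(u, 1)`
(`isEnclosedBy_inter_diff_slit`). Results (`SlitArcData` namespace):

* `hydroMapA` — `g_A`, hydrodynamic; `exists_diffImage_hull_subset_closedBall` —
  **`g_u(Q_u) ⊆ B̄(U_u, ε₀)`** for `1 - u` small;
* `norm_hydroMapA_sub_slitMap_le` — **`‖g_A - g_u‖_∞ ≤ ε₀` on `ℍ ∖ A`** for `1 - u` small;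
* `hcap_hull_sub_hcap_slit_mem_Icc`, `hcap_slit_lt_hcap_hull` — **`b(u) ↑ hcap(A)`**;
* `norm_slitMap_sub_tipVal_le_of_mem_interior` — points enclosed by the path are carried to the
  tip value: `‖g_u(z) - U_u‖ ≤ ε₀` for `z ∈ int A`, `1 - u` small (these are the points swallowed
  at the terminal time of the Loewner chain).

## References

* G. F. Lawler, O. Schramm, W. Werner, *Conformal restriction: the chordal case* (2003), proof
  of Lemma 3.5, p. 13. [LawlerSchrammWerner2003Restriction]
* G. F. Lawler, *Conformally Invariant Processes in the Plane* (2005), §4.1 (Prop. 4.4,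
  Remark 4.5). [Lawler2005]
-/

noncomputable section

open Set Filter Topology Metric Bornology Complex
open UpperHalfPlane (upperHalfPlaneSet isOpen_upperHalfPlaneSet)
open Literature.Analysis.Complex
open scoped Real

namespace Literature.Probability.RandomPlanarGeometry

/-- A preconnected set meeting `s` and `sᶜ` meets `frontier s`. (A copy of the folklore lemma of
`Literature/Algebra/EuclideanLattices/LatticePointCounting.lean`, kept local to avoid the import.)
[folklore] -/
private theorem isPreconnected_inter_frontier_nonempty' {α : Type*} [TopologicalSpace α]
    {c s : Set α} (hc : IsPreconnected c) (h₁ : (c ∩ s).Nonempty) (h₂ : (c ∩ sᶜ).Nonempty) :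
    (c ∩ frontier s).Nonempty := by
  by_contra h
  rw [not_nonempty_iff_eq_empty] at h
  have hcov : c ⊆ interior s ∪ (closure s)ᶜ := by
    intro x hx
    by_contra hx'
    simp only [mem_union, mem_compl_iff, not_or, not_not] at hx'
    have : x ∈ c ∩ frontier s := ⟨hx, hx'.2, hx'.1⟩
    rw [h] at this
    exact this
  have h₁' : (c ∩ interior s).Nonempty := by
    obtain ⟨x, hxc, hxs⟩ := h₁
    rcases hcov hxc with h' | h'
    · exact ⟨x, hxc, h'⟩
    · exact absurd (subset_closure hxs) h'
  have h₂' : (c ∩ (closure s)ᶜ).Nonempty := by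
    obtain ⟨x, hxc, hxs⟩ := h₂
    rcases hcov hxc with h' | h'
    · exact absurd (interior_subset h') hxs
    · exact ⟨x, hxc, h'⟩
  have := hc _ _ isOpen_interior isClosed_closure.isOpen_compl hcov h₁' h₂'
  obtain ⟨x, -, hx1, hx2⟩ := this
  exact hx2 (subset_closure (interior_subset hx1))

namespace SlitArcData

variable {A : Set ℂ} {γ : ℝ → ℂ}

/-! ### The map `g_A` of the hull -/

/-- **The map `g_A : ℍ ∖ A → ℍ`** of the arc hull, hydrodynamically normalized ([LSW] p. 13:
`g_s = g_{E_δ}`). [cite: LawlerSchrammWerner2003Restriction, proof of Lemma 3.5 (p. 13)] -/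
def hydroMapA (h : SlitArcData A γ) : ConformalEquiv (upperHalfPlaneSet \ A) upperHalfPlaneSet :=
  h.isPlusHull.hydroMap h.nonempty

/-- `g_A` is hydrodynamically normalized. [folklore] -/
theorem isHydrodynamicMap_hydroMapA (h : SlitArcData A γ) : IsHydrodynamicMap A h.hydroMapA :=
  h.isPlusHull.isHydrodynamicMap_hydroMap _

/-- `A ∩ ℍ` is bounded. [folklore] -/
theorem isBounded_inter (h : SlitArcData A γ) : IsBounded (A ∩ upperHalfPlaneSet) :=
  h.isPlusHull.isBounded_inter_upperHalfPlaneSet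

/-! ### Topology of the enclosed region -/

/-- Points of `A` have `Im ≥ 0`. [folklore] -/
theorem im_nonneg_of_mem (h : SlitArcData A γ) {z : ℂ} (hz : z ∈ A) : 0 ≤ z.im :=
  h.isPlusHull.im_nonneg hz

/-- The interior of `A` lies in `ℍ`. [folklore] -/
theorem interior_subset_upperHalfPlaneSet (h : SlitArcData A γ) : interior A ⊆ upperHalfPlaneSet := by
  intro z hz
  by_contra hzi
  have hzi' : z.im ≤ 0 := not_lt.1 hzi
  obtain ⟨ε, hε, hball⟩ := Metric.isOpen_iff.1 isOpen_interior z hz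
  have hmem : z - (ε / 2 : ℝ) * I ∈ ball z ε := by
    rw [mem_ball, dist_eq_norm]
    have : z - (ε / 2 : ℝ) * I - z = -((ε / 2 : ℝ) * I) := by ring
    rw [this, norm_neg, norm_mul, norm_real, norm_I, mul_one, Real.norm_of_nonneg (by positivity)]
    linarith
  have := h.im_nonneg_of_mem (interior_subset (hball hmem))
  simp at this
  linarith

/-- `A ∩ ℍ = γ(0, 1) ∪ int A`. [folklore] -/
theorem inter_upperHalfPlaneSet_eq (h : SlitArcData A γ) :
    A ∩ upperHalfPlaneSet = γ '' Ioo 0 1 ∪ interior A := by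
  have hA : A = interior A ∪ frontier A := by
    rw [← closure_eq_interior_union_frontier, h.isClosed.closure_eq]
  ext z
  constructor
  · rintro ⟨hzA, hzH⟩
    rw [hA] at hzA
    rcases hzA with hz | hz
    · exact Or.inr hz
    · have hmem : z ∈ upperHalfPlaneSet ∩ frontier A := ⟨hzH, hz⟩
      rw [h.frontier_eq] at hmem
      exact Or.inl hmem
  · rintro (hz | hz)
    · have hmem : z ∈ upperHalfPlaneSet ∩ frontier A := by rw [h.frontier_eq]; exact hz
      exact ⟨h.image_Ioo_subset hz, hmem.1⟩
    · exact ⟨interior_subset hz, h.interior_subset_upperHalfPlaneSet hz⟩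

/-- The slit misses the interior of `A`. [folklore] -/
theorem slit_inter_interior_eq (h : SlitArcData A γ) {u : ℝ} (hu : u < 1) : slit γ u ∩ interior A = ∅ := by
  ext z
  simp only [mem_inter_iff, mem_empty_iff_false, iff_false, not_and]
  rintro ⟨t, ht, rfl⟩ hint
  have hH := h.interior_subset_upperHalfPlaneSet hint
  rcases ht.1.lt_or_eq with h0 | h0
  · have hfr : γ t ∈ frontier A := by
      have : γ t ∈ upperHalfPlaneSet ∩ frontier A := h.frontier_eq ▸ ⟨t, ⟨h0, ht.2.trans_lt hu⟩, rfl⟩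
      exact this.2
    exact hfr.2 hint
  · rw [← h0] at hH
    have : (0 : ℝ) < (γ 0).im := hH
    linarith [h.im_zero]

/-- The enclosed set `Q_u = (A ∩ ℍ) ∖ γ[0, u] = γ(u, 1) ∪ int A`. [folklore] -/
theorem inter_diff_slit_eq (h : SlitArcData A γ) {u : ℝ} (hu : u ∈ Ioo (0 : ℝ) 1) :
    (A ∩ upperHalfPlaneSet) \ slit γ u = γ '' Ioo u 1 ∪ interior A := by
  rw [h.inter_upperHalfPlaneSet_eq]
  ext z
  constructor
  · rintro ⟨hz | hz, hzs⟩
    · obtain ⟨t, ht, rfl⟩ := hz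
      refine Or.inl ⟨t, ⟨?_, ht.2⟩, rfl⟩
      by_contra hle
      exact hzs ⟨t, ⟨ht.1.le, not_lt.1 hle⟩, rfl⟩
    · exact Or.inr hz
  · rintro (hz | hz)
    · obtain ⟨t, ht, rfl⟩ := hz
      refine ⟨Or.inl ⟨t, ⟨hu.1.trans ht.1, ht.2⟩, rfl⟩, (h.apply_mem_diff_slit hu.1.le ht.1 ht.2).2⟩
    · refine ⟨Or.inr hz, fun hzs ↦ ?_⟩
      have : z ∈ slit γ u ∩ interior A := ⟨hzs, hz⟩
      rw [h.slit_inter_interior_eq hu.2] at this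
      exact this

/-- `(ℍ ∖ γ[0, u]) ∩ A = Q_u`. [folklore] -/
theorem diff_slit_inter_eq (h : SlitArcData A γ) {u : ℝ} (hu : u ∈ Ioo (0 : ℝ) 1) :
    (upperHalfPlaneSet \ slit γ u) ∩ A = γ '' Ioo u 1 ∪ interior A := by
  rw [← h.inter_diff_slit_eq hu]
  ext z
  constructor
  · rintro ⟨⟨hzH, hzs⟩, hzA⟩; exact ⟨⟨hzA, hzH⟩, hzs⟩
  · rintro ⟨⟨hzA, hzH⟩, hzs⟩; exact ⟨⟨hzH, hzs⟩, hzA⟩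

/-- `Q_u ⊆ H_u`. [folklore] -/
theorem enclosed_subset (h : SlitArcData A γ) {u : ℝ} (hu : u ∈ Ioo (0 : ℝ) 1) :
    γ '' Ioo u 1 ∪ interior A ⊆ upperHalfPlaneSet \ slit γ u := by
  rw [← h.diff_slit_inter_eq hu]; exact inter_subset_left

/-- **Every component of `int A` accumulates at the remaining arc `γ(u, 1)`**: otherwise it
would be a bounded, relatively clopen, proper subset of the connected `H_u`. [folklore] -/
theorem exists_mem_closure_component (h : SlitArcData A γ) {u : ℝ} (hu : u ∈ Ioo (0 : ℝ) 1)
    {z : ℂ} (hz : z ∈ interior A) :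
    ∃ x ∈ γ '' Ioo u 1, x ∈ closure (connectedComponentIn (interior A) z) := by
  set C := connectedComponentIn (interior A) z with hC
  set V := upperHalfPlaneSet \ slit γ u with hV
  by_contra hcon
  push Not at hcon
  have hCo : IsOpen C := isOpen_interior.connectedComponentIn
  have hCV : C ⊆ V := (connectedComponentIn_subset _ _).trans
    (subset_union_right.trans (h.enclosed_subset hu))
  have hzC : z ∈ C := mem_connectedComponentIn hz
  -- `closure C ∩ V ⊆ C`
  have hcl : closure C ∩ V ⊆ C := by
    rintro w ⟨hwcl, hwV⟩
    have hwA : w ∈ A := h.isClosed.closure_subset_iff.2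
      ((connectedComponentIn_subset _ _).trans interior_subset) hwcl
    by_cases hwint : w ∈ interior A
    · -- components of an open set are closed in it
      obtain ⟨ε, hε, hball⟩ := Metric.isOpen_iff.1 isOpen_interior w hwint
      obtain ⟨y, hyb, hyC⟩ : (ball w ε ∩ C).Nonempty :=
        mem_closure_iff_nhds.1 hwcl (ball w ε) (ball_mem_nhds w hε)
      have hsub : ball w ε ⊆ C := by
        have h1 : ball w ε ∪ C ⊆ connectedComponentIn (interior A) z := by
          refine (IsPreconnected.union' ⟨y, hyb, hyC⟩ (convex_ball w ε).isPreconnected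
            isPreconnected_connectedComponentIn).subset_connectedComponentIn (Or.inr hzC) ?_
          exact union_subset hball (connectedComponentIn_subset _ _)
        exact subset_union_left.trans h1
      exact hsub (mem_ball_self hε)
    · exfalso
      have hwfr : w ∈ frontier A := by
        rw [frontier_eq_closure_inter_closure, h.isClosed.closure_eq]
        refine ⟨hwA, ?_⟩
        rw [closure_compl, mem_compl_iff]
        exact hwint
      have hw' : w ∈ upperHalfPlaneSet ∩ frontier A := ⟨hwV.1, hwfr⟩
      rw [h.frontier_eq] at hw'
      obtain ⟨t, ht, rfl⟩ := hw'
      have hut : u < t := by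
        by_contra hle
        exact hwV.2 ⟨t, ⟨ht.1.le, not_lt.1 hle⟩, rfl⟩
      exact hcon (γ t) ⟨t, ⟨hut, ht.2⟩, rfl⟩ hwcl
  have hVc : IsPreconnected V := (IsHydrodynamicMap.isConnected_diff (h.slitMap hu)).isPreconnected
  have hVC : V ⊆ C := hVc.subset_of_closure_inter_subset hCo ⟨z, hCV hzC, hzC⟩ hcl
  -- `V` is unbounded but `C ⊆ A` is bounded
  have hbdd : IsBounded V := (h.isCompact.isBounded.subset
    ((connectedComponentIn_subset _ _).trans interior_subset)).subset hVC
  obtain ⟨R, hR⟩ := hbdd.subset_closedBall 0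
  obtain ⟨R₁, hR₁, hfar⟩ := IsHydrodynamicMap.exists_forall_mul_I_mem (h.isBounded_slit_inter hu.2)
  set M : ℝ := max R R₁ + 1 with hM
  have hM0 : 0 < M := by rw [hM]; linarith [le_max_right R R₁]
  set y : ℂ := (M : ℂ) * I with hy
  have hyn : ‖y‖ = M := by rw [hy, norm_mul, norm_real, norm_I, mul_one, Real.norm_of_nonneg hM0.le]
  have hyH : y ∈ upperHalfPlaneSet := by show 0 < y.im; rw [hy]; simpa using hM0
  have hyV : y ∈ V := hfar y hyH (by rw [hyn, hM]; linarith [le_max_right R R₁])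
  have := hR hyV
  rw [mem_closedBall, dist_zero_right, hyn, hM] at this
  linarith [le_max_left R R₁]

/-- **The enclosed set `Q_u = γ(u, 1) ∪ int A` is preconnected.** [folklore] -/
theorem isPreconnected_enclosed (h : SlitArcData A γ) {u : ℝ} (hu : u ∈ Ioo (0 : ℝ) 1) :
    IsPreconnected (γ '' Ioo u 1 ∪ interior A) := by
  set Γ : Set ℂ := γ '' Ioo u 1 with hΓ
  have hΓc : IsPreconnected Γ :=
    isPreconnected_Ioo.image _ (h.continuousOn.mono fun t ht ↦ ⟨hu.1.le.trans ht.1.le, ht.2.le⟩)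
  set x₀ : ℂ := γ ((u + 1) / 2) with hx₀
  have hx₀Γ : x₀ ∈ Γ := ⟨(u + 1) / 2, ⟨by linarith [hu.2], by linarith [hu.2]⟩, rfl⟩
  set c : Set (Set ℂ) := insert Γ ((fun z ↦ (connectedComponentIn (interior A) z ∪
    {y | y ∈ Γ ∧ y ∈ closure (connectedComponentIn (interior A) z)}) ∪ Γ) '' interior A) with hc
  have heq : Γ ∪ interior A = ⋃₀ c := by
    apply Subset.antisymm
    · rintro z (hz | hz)
      · exact ⟨Γ, mem_insert _ _, hz⟩
      · exact ⟨_, mem_insert_of_mem _ ⟨z, hz, rfl⟩, Or.inl (Or.inl (mem_connectedComponentIn hz))⟩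
    · rintro z ⟨s, hs, hzs⟩
      rcases hs with rfl | ⟨w, hw, rfl⟩
      · exact Or.inl hzs
      · rcases hzs with (hz | hz) | hz
        · exact Or.inr (connectedComponentIn_subset _ _ hz)
        · exact Or.inl hz.1
        · exact Or.inl hz
  rw [heq]
  refine isPreconnected_sUnion x₀ c (fun s hs ↦ ?_) (fun s hs ↦ ?_)
  · rcases hs with rfl | ⟨w, hw, rfl⟩
    · exact hx₀Γ
    · exact Or.inr hx₀Γ
  · rcases hs with rfl | ⟨w, hw, rfl⟩
    · exact hΓc
    · obtain ⟨x, hxΓ, hxcl⟩ := h.exists_mem_closure_component hu hw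
      have h1 : IsPreconnected (connectedComponentIn (interior A) w ∪
          {y | y ∈ Γ ∧ y ∈ closure (connectedComponentIn (interior A) w)}) :=
        isPreconnected_connectedComponentIn.subset_closure subset_union_left
          (union_subset subset_closure fun y hy ↦ hy.2)
      exact h1.union' ⟨x, Or.inr ⟨hxΓ, hxcl⟩, hxΓ⟩ hΓc

/-- **Enclosure**: every path in `H_u` from `Q_u` to a point of modulus `≥ R + ‖γ 0‖ + 1` passes
through the arc `γ(u, 1)`, hence within `d` of `γ(1)` if `‖γ(t) - γ(1)‖ ≤ d` on `[u, 1]`.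
[folklore] -/
theorem isEnclosedBy_enclosed (h : SlitArcData A γ) {u : ℝ} (hu : u ∈ Ioo (0 : ℝ) 1) {d : ℝ}
    (hd : ∀ t ∈ Icc u 1, ‖γ t - γ 1‖ ≤ d) :
    LengthArea.IsEnclosedBy (upperHalfPlaneSet \ slit γ u) (γ '' Ioo u 1 ∪ interior A) (γ 1) d
      (radius A γ + ‖γ 0‖ + 1) := by
  intro p a b hab hpc hpU hpa hpb
  -- the path starts in `A` and ends outside `A`
  have hpaA : p a ∈ A := by
    rcases hpa with hz | hz
    · exact h.image_Ioo_subset (image_mono (Ioo_subset_Ioo hu.1.le le_rfl) hz)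
    · exact interior_subset hz
  have hpbA : p b ∉ A := fun hmem ↦ by
    have h1 := h.norm_sub_le_radius hmem
    have h2 : ‖p b‖ ≤ ‖p b - γ 0‖ + ‖γ 0‖ := norm_le_norm_sub_add _ _
    linarith
  have hconn : IsPreconnected (p '' Icc a b) := isPreconnected_Icc.image _ hpc
  obtain ⟨_, ⟨s, hs, rfl⟩, hfr⟩ := isPreconnected_inter_frontier_nonempty' hconn
    ⟨p a, ⟨a, left_mem_Icc.2 hab, rfl⟩, hpaA⟩ ⟨p b, ⟨b, right_mem_Icc.2 hab, rfl⟩, hpbA⟩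
  have hsU := hpU s hs
  have hmem : p s ∈ upperHalfPlaneSet ∩ frontier A := ⟨hsU.1, hfr⟩
  rw [h.frontier_eq] at hmem
  obtain ⟨t, ht, hts⟩ := hmem
  have hut : u < t := by
    by_contra hle
    exact hsU.2 ⟨t, ⟨ht.1.le, not_lt.1 hle⟩, hts⟩
  exact ⟨s, hs, by rw [← hts]; exact hd t ⟨hut.le, ht.2.le⟩⟩

/-! ### The collapse of the enclosed region and `g_u → g_A` -/

/-- **`g_u(Q_u)` collapses to the tip value**: for every `ε₀ > 0` there is `θ > 0` such that for
`1 - u < θ`, `‖g_u(q) - U_u‖ ≤ ε₀` for all `q ∈ Q_u = γ(u, 1) ∪ int A`. (Length–area for the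
enclosed preconnected `Q_u`; `U_u` is the limit of `g_u(γ(t))`, `t ↓ u`.)
[cite: LawlerSchrammWerner2003Restriction, proof of Lemma 3.5 (p. 13, Φ_s = Φ_{E_δ})] -/
theorem norm_slitMap_sub_tipVal_le_of_mem_enclosed (h : SlitArcData A γ) {ε₀ : ℝ} (hε₀ : 0 < ε₀) :
    ∃ θ > 0, ∀ ⦃u : ℝ⦄ (hu : u ∈ Ioo (0 : ℝ) 1), 1 - u < θ →
      ∀ q ∈ γ '' Ioo u 1 ∪ interior A, ‖h.slitMap hu q - h.tipVal hu‖ ≤ ε₀ := by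
  obtain ⟨d, hd, hd2, hdω⟩ := h.exists_modulus_le hε₀
  have hd1 : d < 1 := by linarith
  obtain ⟨θ, hθ, hγθ⟩ := h.exists_forall_norm_sub_lt hd
  refine ⟨θ, hθ, fun u hu huθ q hq ↦ ?_⟩
  have hdist : ∀ t ∈ Icc u 1, ‖γ t - γ 1‖ ≤ d := fun t ht ↦
    (hγθ t ⟨hu.1.le.trans ht.1, ht.2⟩ 1 ⟨zero_le_one, le_rfl⟩ (by
      rw [abs_of_nonpos (by linarith [ht.2])]; linarith [ht.1])).le
  have henc := h.isEnclosedBy_enclosed hu hdist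
  have hQc := h.isPreconnected_enclosed hu
  have hQU := h.enclosed_subset hu
  have hdiam : ∀ a ∈ γ '' Ioo u 1 ∪ interior A, ∀ b ∈ γ '' Ioo u 1 ∪ interior A,
      ‖h.slitMap hu a - h.slitMap hu b‖ ≤ ε₀ := fun a ha b hb ↦
    (h.norm_slitMap_sub_slitMap_le_modulus_of_isEnclosedBy hu hQc hQU hd hd1 henc ha hb).trans hdω
  -- pass to the limit `b = γ t`, `t ↓ u`
  haveI := h.nhdsWithin_tip_neBot hu
  have hlim : Tendsto (fun z ↦ ‖h.slitMap hu q - h.slitMap hu z‖)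
      (𝓝[upperHalfPlaneSet \ slit γ u] (γ u)) (𝓝 ‖h.slitMap hu q - h.tipVal hu‖) :=
    (tendsto_const_nhds.sub (h.tendsto_slitMap_tip hu)).norm
  -- along the curve: the filter `map γ (𝓝[>] u)` is finer
  have hγt : Tendsto γ (𝓝[>] u) (𝓝[upperHalfPlaneSet \ slit γ u] (γ u)) :=
    tendsto_nhdsWithin_iff.2 ⟨h.tendsto_nhdsGT ⟨hu.1.le, hu.2⟩, by
      filter_upwards [Ioo_mem_nhdsGT hu.2] with t ht
      exact h.apply_mem_diff_slit hu.1.le ht.1 ht.2⟩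
  have hlim' := hlim.comp hγt
  refine le_of_tendsto hlim' ?_
  filter_upwards [Ioo_mem_nhdsGT hu.2] with t ht
  exact hdiam q hq (γ t) (Or.inl ⟨t, ht, rfl⟩)

/-- **`g_u((A ∩ ℍ) ∖ γ[0,u]) ⊆ B̄(U_u, ε₀)`** for `1 - u` small: the image hull of `A` under
`g_u` is a small hull about the tip value. [cite: LawlerSchrammWerner2003Restriction, proof of Lemma 3.5 (p. 13)] -/
theorem exists_diffImage_hull_subset_closedBall (h : SlitArcData A γ) {ε₀ : ℝ} (hε₀ : 0 < ε₀) :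
    ∃ θ > 0, ∀ ⦃u : ℝ⦄ (hu : u ∈ Ioo (0 : ℝ) 1), 1 - u < θ →
      diffImage (h.slitMap hu) A ⊆ closedBall ((h.tipVal hu : ℝ) : ℂ) ε₀ := by
  obtain ⟨θ, hθ, hB⟩ := h.norm_slitMap_sub_tipVal_le_of_mem_enclosed hε₀
  refine ⟨θ, hθ, fun u hu huθ ↦ ?_⟩
  rw [diffImage, h.diff_slit_inter_eq hu]
  rintro _ ⟨q, hq, rfl⟩
  rw [mem_closedBall, dist_eq_norm]
  exact hB hu huθ q hq

/-- **`‖g_A - g_u‖_∞ ≤ ε₀` on `ℍ ∖ A`** for `1 - u` small (`g_A = g_{u,A} ∘ g_u` with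
`|g_{u,A} - id| ≤ 580 rad g_u(Q_u)`). [cite: LawlerSchrammWerner2003Restriction, proof of Lemma 3.5 (p. 13)] -/
theorem norm_hydroMapA_sub_slitMap_le (h : SlitArcData A γ) {ε₀ : ℝ} (hε₀ : 0 < ε₀) :
    ∃ θ > 0, ∀ ⦃u : ℝ⦄ (hu : u ∈ Ioo (0 : ℝ) 1), 1 - u < θ →
      ∀ z ∈ upperHalfPlaneSet \ A, ‖h.hydroMapA z - h.slitMap hu z‖ ≤ ε₀ := by
  obtain ⟨θ, hθ, hK⟩ := h.exists_diffImage_hull_subset_closedBall (by positivity : 0 < ε₀ / 580)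
  refine ⟨θ, hθ, fun u hu huθ z hz ↦ ?_⟩
  have h12 := h.diff_subset_diff_slit hu.2
  have hψ := (h.isHydrodynamicMap_slitMap hu).diffQuotient h.isHydrodynamicMap_hydroMapA
    (h.isBounded_slit_inter hu.2) h12
  have hKx : diffImage (h.slitMap hu) A ∩ upperHalfPlaneSet ⊆
      closedBall ((h.tipVal hu : ℝ) : ℂ) (ε₀ / 580) := inter_subset_left.trans (hK hu huθ)
  have := hψ.norm_sub_self_le hKx (by positivity) (mapsTo_diff_diffImage h12 hz)
  rw [diffQuotient_apply_apply h12 hz] at this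
  linarith

/-- **`0 ≤ hcap(A) - b(u) ≤ ε₀`** for `1 - u` small. [cite: LawlerSchrammWerner2003Restriction, proof of Lemma 3.5 (p. 13)] -/
theorem hcap_hull_sub_hcap_slit_mem_Icc (h : SlitArcData A γ) {ε₀ : ℝ} (hε₀ : 0 < ε₀) :
    ∃ θ > 0, ∀ ⦃u : ℝ⦄ (hu : u ∈ Ioo (0 : ℝ) 1), 1 - u < θ →
      hcap A h.hydroMapA - hcap (slit γ u) (h.slitMap hu) ∈ Icc 0 ε₀ := by
  set r : ℝ := min 1 (ε₀ / 288) with hr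
  have hr0 : 0 < r := lt_min one_pos (by positivity)
  obtain ⟨θ, hθ, hK⟩ := h.exists_diffImage_hull_subset_closedBall hr0
  refine ⟨θ, hθ, fun u hu huθ ↦ ?_⟩
  have h12 := h.diff_subset_diff_slit hu.2
  have h₁ := h.isHydrodynamicMap_slitMap hu
  have h₂ := h.isHydrodynamicMap_hydroMapA
  have hb₁ := h.isBounded_slit_inter hu.2
  have hb₂ := h.isBounded_inter
  have hψ := h₁.diffQuotient h₂ hb₁ h12
  have hadd := h₁.hcap_diffQuotient h₂ hb₁ hb₂ h12
  have hKx : diffImage (h.slitMap hu) A ∩ upperHalfPlaneSet ⊆ closedBall ((h.tipVal hu : ℝ) : ℂ) r :=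
    inter_subset_left.trans (hK hu huθ)
  have hle := hψ.hcap_le hKx hr0
  have hnn := hψ.hcap_nonneg (h₁.isBounded_diffImage hb₁ hb₂)
  rw [hadd] at hle hnn
  refine ⟨hnn, hle.trans ?_⟩
  have hr1 : r ≤ 1 := min_le_left _ _
  have hrε : r ≤ ε₀ / 288 := min_le_right _ _
  nlinarith

/-- **`b(u) < hcap(A)`** for every `u < 1` (the image hull `g_u(Q_u) ⊇ g_u(γ(u,1))` is nonempty). [cite: Lawler2005, §3.4 (3.8)] -/
theorem hcap_slit_lt_hcap_hull (h : SlitArcData A γ) {u : ℝ} (hu : u ∈ Ioo (0 : ℝ) 1) :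
    hcap (slit γ u) (h.slitMap hu) < hcap A h.hydroMapA := by
  have h12 := h.diff_subset_diff_slit hu.2
  have h₁ := h.isHydrodynamicMap_slitMap hu
  have h₂ := h.isHydrodynamicMap_hydroMapA
  have hb₁ := h.isBounded_slit_inter hu.2
  have hb₂ := h.isBounded_inter
  have hψ := h₁.diffQuotient h₂ hb₁ h12
  have hadd := h₁.hcap_diffQuotient h₂ hb₁ hb₂ h12
  set t : ℝ := (u + 1) / 2 with ht
  have ht' : t ∈ Ioo u 1 := ⟨by rw [ht]; linarith [hu.2], by rw [ht]; linarith [hu.2]⟩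
  have hmem : γ t ∈ upperHalfPlaneSet \ slit γ u := h.apply_mem_diff_slit hu.1.le ht'.1 ht'.2
  have hne : (diffImage (h.slitMap hu) A ∩ upperHalfPlaneSet).Nonempty := by
    refine ⟨h.slitMap hu (γ t), ?_, (h.slitMap hu).mapsTo hmem⟩
    rw [diffImage, h.diff_slit_inter_eq hu]
    exact ⟨γ t, Or.inl ⟨t, ht', rfl⟩, rfl⟩
  have hpos := hψ.hcap_pos (h₁.isBounded_diffImage hb₁ hb₂) hne
  rw [hadd] at hpos
  linarith

/-- **Enclosed points are carried to the tip value**: `‖g_u(z) - U_u‖ ≤ ε₀` for `z ∈ int A` and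
`1 - u` small. [cite: LawlerSchrammWerner2003Restriction, proof of Lemma 3.5 (p. 13)] -/
theorem norm_slitMap_sub_tipVal_le_of_mem_interior (h : SlitArcData A γ) {ε₀ : ℝ} (hε₀ : 0 < ε₀) :
    ∃ θ > 0, ∀ ⦃u : ℝ⦄ (hu : u ∈ Ioo (0 : ℝ) 1), 1 - u < θ →
      ∀ z ∈ interior A, ‖h.slitMap hu z - h.tipVal hu‖ ≤ ε₀ := by
  obtain ⟨θ, hθ, hB⟩ := h.norm_slitMap_sub_tipVal_le_of_mem_enclosed hε₀
  exact ⟨θ, hθ, fun u hu huθ z hz ↦ hB hu huθ z (Or.inr hz)⟩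

/-- `hcap(A) > 0`. [cite: Lawler2005, §3.4 (3.8)] -/
theorem hcap_hull_pos (h : SlitArcData A γ) : 0 < hcap A h.hydroMapA :=
  h.isPlusHull.hcap_hydroMap_pos _

/-- `|g_A(z) - z| ≤ 580 R` on `ℍ ∖ A`. [cite: Lawler2005, §3.4 (3.12)] -/
theorem norm_hydroMapA_sub_self_le (h : SlitArcData A γ) {z : ℂ} (hz : z ∈ upperHalfPlaneSet \ A) :
    ‖h.hydroMapA z - z‖ ≤ 580 * radius A γ :=
  h.isHydrodynamicMap_hydroMapA.norm_sub_self_le (inter_subset_left.trans h.subset_closedBall) h.radius_pos hz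

end SlitArcData

end Literature.Probability.RandomPlanarGeometry
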